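import Literature.NumberTheory.EllipticCurves.PAdicLFunctionTameMultProofs
import Literature.NumberTheory.EllipticCurves.PAdicLFunctionTameIntegralityAtTwoProofs
import Literature.NumberTheory.EllipticCurves.PAdicLFunctionTameCongruenceProofs
import HarnessLib

/-!
# The one-term tame `2`-adic transform at a MULTIPLICATIVE `2` is integral, and Matsuno's Lemma 3.2 at `p = 2`:
# `L₂(f, a₂, χ, T) ∈ ℤ₂⟦T⟧` and `L₂(f, a₂, χ) ≡ L₂(f, a₂, 𝟙_m) (mod 2Λ)` for `χ` even quadratic, `(m, 2N) = 1`
# (INT2-AUTO-sp, -ns at tame level; PROOFS ONLY: no `def`, no named fact)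

Companion of `PAdicLFunctionTameMult` (cell bsd-2adic, seat conv-1 GEN 13, road «hKan-mult»); the one-term twin of
`PAdicLFunctionTameIntegralityAtTwoProofs` / `PAdicLFunctionTameCongruenceAtTwoAutoProofs`. For the newform `f` (level `N`,
`2 ‖ N`) of `E = W/ℚ` MULTIPLICATIVE at `2`, `a₂ = a₂(f) ∈ {1, −1}`, an odd tame modulus `m` prime to `N`, and an EVEN
`ℚ₂`-valued character `χ` mod `m`:

* §1 `msdMeasureTameMult_neg`, `padicLRiemannSumTameMult_two_of_even` — evenness of the one-term measure and the
  `Δ = {±1}` DOUBLING of the Riemann sums at `p = 2` (as for the two-term measure);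
* §2 **`norm_ratPlusSymbol_tameFraction_le_two_of_mult_two`** — `‖[c/(2ⁿm)]⁺_f‖₂ ≤ 2` for `n ≥ 1`, `c` odd and prime to `m`
  (the unit classes): the cusp `c/(2ⁿm)` is `Γ₀(N)`-equivalent to `1/2` (`N = 2M`, `M` odd, `gcd(2ⁿm, M) = 1`; Cremona Lemma
  2.2.3 = tree `modularSymbol_div_sub_half_mem_periodLattice`), so `[c/(2ⁿm)]⁺ − [1/2]⁺ ∈ ½ℤ`
  (`exists_ratPlusSymbol_sub_eq_div_two_of_sub_mem`), and `[1/2]⁺ = 0` (split, `a₂ = 1`) or `= −2[0]⁺` with `6[0]⁺ ∈ ℤ`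
  (non-split) — the tame extension of INT2-AUTO-sp, -ns (`norm_ratPlusSymbol_val_div_le_two_of_split, _of_nonsplit`);
  hence `‖χ(b) μ¹_{f,a₂,m}((a + 2ⁿℤ₂) × {b})‖ ≤ 2` at every unit class `a` (`msdMeasureTameMult`, `‖a₂⁻¹‖ = 1`, `χ(b) = 0` off units);
* §3 `norm_padicLCoeffTameMult_two_le_one`, `exists_iwasawaToPowerSeries_eq_padicLFunctionTameMult_two` — every coefficient
  of `L₂(f, a₂, χ, T)` lies in `ℤ₂` (each Riemann sum is `2 ×` a sum of terms of norm `≤ 2`; the Riemann sums converge,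
  `tendsto_padicLRiemannSumTameMult`; the unit ball is closed);
* §4 `norm_padicLCoeffTameMult_sub_one_two_le`, **`exists_iwasawa_pair_map_toZMod_eq_two_mult`** — Matsuno 2000 Lemma 3.2 at
  `p = 2` for the one-term transform: for `χ` even QUADRATIC, `L₂(f,a₂,χ) ≡ L₂(f,a₂,𝟙_m) (mod 2Λ)` as reductions of integral
  lifts (`‖χ(b) − 1‖ ≤ ‖2‖` on units, the doubling, `exists_iwasawa_pair_map_toZMod_eq`).

NO hypothesis on `E[2]`, the `2`-adic image or the Manin constant (as INT2-AUTO-sp, -ns).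

References: K. Matsuno, J. Number Theory 84 (2000), Lemma 3.2 (p. 87) [Matsuno2000]; B. Mazur, J. Tate, J. Teitelbaum,
Invent. Math. 84 (1986), §I.8, §I.10, §I.12–I.13 [MazurTateTeitelbaum1986Invent]; J. E. Cremona, *Algorithms for modular
elliptic curves* (1997), §2.2 Lemma 2.2.3, §2.8 [CremonaAlgorithms1997].
-/

noncomputable section

open scoped MatrixGroups ModularForm

open CongruenceSubgroup Filter Topology WeierstrassCurve Literature.NumberTheory.EllipticCurves.ModularForms

namespace Literature.NumberTheory.EllipticCurves

/-! ### §1. Evenness of the one-term measure and the `Δ = {±1}` doubling at `p = 2` -/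

section Evenness

variable {N : ℕ} [NeZero N] (f : CuspForm (Gamma0 N) 2) {p : ℕ} [Fact p.Prime] {m : ℕ} [NeZero m]

omit [NeZero N] [NeZero m] in
/-- The representatives of `(−a mod pⁿ, −b mod m)` and `(a mod pⁿ, b mod m)` add up to a multiple of `pⁿm`; private helper.
[folklore] -/
private theorem dvd_tameRep_neg_add' [NeZero m] (hmp : m.Coprime p) (n : ℕ) (a : ZMod (p ^ n)) (b : ZMod m) :
    p ^ n * m ∣ tameRep p m n (-a) (-b) + tameRep p m n a b := by
  have hp : p.Prime := Fact.out
  have h1 : tameRep p m n (-a) (-b) + tameRep p m n a b ≡ 0 [MOD p ^ n] :=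
    (ZMod.natCast_eq_natCast_iff _ _ _).mp (by
      rw [Nat.cast_add, natCast_tameRep_left hp hmp, natCast_tameRep_left hp hmp, neg_add_cancel, Nat.cast_zero])
  have h2 : tameRep p m n (-a) (-b) + tameRep p m n a b ≡ 0 [MOD m] :=
    (ZMod.natCast_eq_natCast_iff _ _ _).mp (by
      rw [Nat.cast_add, natCast_tameRep_right hmp, natCast_tameRep_right hmp, neg_add_cancel, Nat.cast_zero])
  exact (Nat.modEq_zero_iff_dvd.mp ((Nat.modEq_and_modEq_iff_modEq_mul (hmp.symm.pow_left n)).mp ⟨h1, h2⟩))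

omit [NeZero N] in
/-- The tame fraction of `(−a, −b)` is MINUS that of `(a, b)` up to an integer; private helper. [folklore] -/
private theorem exists_tameFraction_neg_eq' (hmp : m.Coprime p) (n : ℕ) (a : ZMod (p ^ n)) (b : ZMod m) :
    ∃ z : ℤ, tameFraction p m n (-a) (-b) = -tameFraction p m n a b + z := by
  have hp : p.Prime := Fact.out
  obtain ⟨z, hz⟩ := dvd_tameRep_neg_add' hmp n a b
  refine ⟨z, ?_⟩
  have hD : ((p : ℚ) ^ n * m) ≠ 0 :=
    mul_ne_zero (pow_ne_zero _ (by exact_mod_cast hp.ne_zero)) (by exact_mod_cast NeZero.ne m)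
  have hz' : (tameRep p m n (-a) (-b) : ℚ) = (p : ℚ) ^ n * m * z - tameRep p m n a b := by
    have h := congrArg (Nat.cast : ℕ → ℚ) hz
    push_cast at h
    linear_combination h
  unfold tameFraction
  rw [hz', sub_div, mul_div_cancel_left₀ _ hD]
  push_cast
  ring

/-- **The one-term tame measure is even**: `μ¹_{f,α,m}((−a + pⁿℤ_p) × {−b}) = μ¹_{f,α,m}((a + pⁿℤ_p) × {b})` (`(m, p) = 1`), by
`[−r]⁺_f = [r]⁺_f` and `[r + z]⁺_f = [r]⁺_f`. [cite: MazurTateTeitelbaum1986Invent, §I.8 and §I.10 (10.1) (pp. 10–13)] -/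
theorem msdMeasureTameMult_neg (hmp : m.Coprime p) (α : ℚ_[p]) (n : ℕ) (a : ZMod (p ^ n)) (b : ZMod m) :
    msdMeasureTameMult f m α n (-a) (-b) = msdMeasureTameMult f m α n a b := by
  obtain ⟨z, hz⟩ := exists_tameFraction_neg_eq' hmp n a b
  have h1 : ratPlusSymbol f (tameFraction p m n (-a) (-b)) = ratPlusSymbol f (tameFraction p m n a b) := by
    rw [hz, ratPlusSymbol_add_intCast_eq, ratPlusSymbol_neg]
  simp only [msdMeasureTameMult, h1]

end Evenness

section Two

variable {N : ℕ} [NeZero N] (f : CuspForm (Gamma0 N) 2) {m : ℕ} [NeZero m]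

/-- The `2`-adic roots of unity of order dividing `2` are `±1`; private helper. [folklore] -/
private theorem coe_rootsOfUnity_two_eq_one_or' (ξ : rootsOfUnity 2 ℤ_[2]) :
    ((ξ : ℤ_[2]ˣ) : ℤ_[2]) = 1 ∨ ((ξ : ℤ_[2]ˣ) : ℤ_[2]) = -1 := by
  have h := ξ.2
  rw [mem_rootsOfUnity] at h
  have h' : (((ξ : ℤ_[2]ˣ) : ℤ_[2])) ^ 2 = 1 := by
    rw [← Units.val_pow_eq_pow_val, h, Units.val_one]
  exact sq_eq_one_iff.mp h'

/-- **The `Δ`-doubling at `p = 2`, one-term measure, EVEN character**: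
`padicLRiemannSumTameMult f m α χ k n = 2 · Σ_{s mod 2ⁿ} Σ_{b mod m} χ(b) μ¹_{f,α,m}((5ˢ + 2ⁿ⁺²ℤ₂) × {b}) · C(s,k)` — the torsion
of `ℤ₂^×` is `{±1}` and the `−1` half equals the `+1` half after `b ↦ −b` (`msdMeasureTameMult_neg`, `χ(−b) = χ(b)`).
[cite: MazurTateTeitelbaum1986Invent, §I.13 (pp. 18–19; p = 2: Δ = {±1}, γ = 5)] -/
theorem padicLRiemannSumTameMult_two_of_even (hm2 : m.Coprime 2) (α : ℚ_[2]) (χ : DirichletCharacter ℚ_[2] m)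
    (hχ : χ.Even) (k n : ℕ) :
    padicLRiemannSumTameMult f m α χ k n =
      2 * ∑ s : ZMod (2 ^ n), ∑ b : ZMod m,
        χ b * msdMeasureTameMult f m α (n + 2) ((cyclotomicGenerator 2 : ZMod (2 ^ (n + 2))) ^ s.val) b *
          (s.val.choose k : ℚ_[2]) := by
  classical
  have hχ' : χ (-1) = 1 := hχ
  set G : ℤ_[2] → ℚ_[2] := fun u ↦ ∑ s : ZMod (2 ^ n), ∑ b : ZMod m,
    χ b * msdMeasureTameMult f m α (n + 2) (PadicInt.toZModPow (n + 2) u *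
        (cyclotomicGenerator 2 : ZMod (2 ^ (n + 2))) ^ s.val) b * (s.val.choose k : ℚ_[2]) with hG
  have hG1 : G 1 = ∑ s : ZMod (2 ^ n), ∑ b : ZMod m,
      χ b * msdMeasureTameMult f m α (n + 2) ((cyclotomicGenerator 2 : ZMod (2 ^ (n + 2))) ^ s.val) b *
        (s.val.choose k : ℚ_[2]) := by
    simp only [hG, map_one, one_mul]
  have hGneg : G (-1) = G 1 := by
    simp only [hG, map_neg, map_one, neg_one_mul, one_mul]
    refine Finset.sum_congr rfl fun s _ ↦ ?_
    refine Fintype.sum_equiv (Equiv.neg (ZMod m)) _ _ fun b ↦ ?_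
    rw [Equiv.neg_apply, show χ (-b) = χ b by rw [← neg_one_mul, map_mul, hχ', one_mul],
      ← msdMeasureTameMult_neg f hm2 α (n + 2) _ (-b), neg_neg]
  have hζmem : (-1 : ℤ_[2]ˣ) ∈ rootsOfUnity 2 ℤ_[2] := by
    rw [mem_rootsOfUnity]; norm_num
  set ζ : rootsOfUnity 2 ℤ_[2] := ⟨-1, hζmem⟩ with hζ
  have hne : (1 : rootsOfUnity 2 ℤ_[2]) ≠ ζ := by
    intro h
    have h' : (((1 : rootsOfUnity 2 ℤ_[2]) : ℤ_[2]ˣ) : ℤ_[2]) = ((ζ : ℤ_[2]ˣ) : ℤ_[2]) := by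
      rw [h]
    rw [hζ] at h'
    simp only [OneMemClass.coe_one, Units.val_one, Units.val_neg] at h'
    have h2 : (2 : ℤ_[2]) = 0 := by linear_combination h'
    exact two_ne_zero h2
  haveI : Fintype (rootsOfUnity 2 ℤ_[2]) := Fintype.ofFinite _
  have huniv : (Finset.univ : Finset (rootsOfUnity 2 ℤ_[2])) = {1, ζ} := by
    ext ξ
    simp only [Finset.mem_univ, Finset.mem_insert, Finset.mem_singleton, true_iff]
    rcases coe_rootsOfUnity_two_eq_one_or' ξ with h | h
    · left
      exact Subtype.ext (Units.ext (by simpa using h))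
    · right
      exact Subtype.ext (Units.ext (by rw [hζ]; simpa using h))
  have hRS : padicLRiemannSumTameMult f m α χ k n =
      ∑ᶠ ξ : rootsOfUnity (torsionOrder 2) ℤ_[2], G ((ξ : ℤ_[2]ˣ) : ℤ_[2]) := by
    rw [padicLRiemannSumTameMult]
    rfl
  rw [hRS, torsionOrder_two, finsum_eq_sum_of_fintype, huniv, Finset.sum_pair hne]
  simp only [OneMemClass.coe_one, Units.val_one, hζ, Units.val_neg]
  rw [hGneg, hG1, two_mul]

end Two

/-! ### §2. `‖[c/(2ⁿm)]⁺_f‖₂ ≤ 2` at the unit classes, for `f` the newform of a curve multiplicative at `2` -/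

section Symbols

variable {N : ℕ} [NeZero N] {f : CuspForm (Gamma0 N) 2} {m : ℕ} [NeZero m]
  {W : WeierstrassCurve ℚ}

omit [NeZero m] in
/-- For the newform `f` (level `N`) of a curve MULTIPLICATIVE at `2`: `2 ∣ N`, `4 ∤ N`, `a₂(f) ∈ {1, −1}`, and
`‖[1/2]⁺_f‖₂ ≤ 1` (`[1/2]⁺ = 0` if split, `= −2[0]⁺` with `‖[0]⁺‖₂ ≤ 2` if non-split — INT2-AUTO-sp, -ns). Bookkeeping over
the tree's split / non-split lemmas. [cite: MazurTateTeitelbaum1986Invent, §I.4 (4.2) and §I.10 (ε(p) = 0)]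
[cite: CremonaAlgorithms1997, §2.2 Lemma 2.2.3] -/
theorem two_dvd_level_and_norm_ratPlusSymbol_half_le_one_of_mult_two (hf : IsNewformOf W f)
    (hmult : W.HasMultiplicativeReductionAtPrime 2) :
    2 ∣ N ∧ ¬ 4 ∣ N ∧ (cuspCoeff f 2 = 1 ∨ cuspCoeff f 2 = -1) ∧
      ‖((ratPlusSymbol f (1 / 2) : ℚ) : ℚ_[2])‖ ≤ 1 := by
  have hQ : coeffField f = ⊥ := hf.coeffField_eq_bot
  have hrat : ∀ r : ℚ, (ratPlusSymbol f r : ℝ) = normalizedPlusSymbol f r := ratCast_ratPlusSymbol_holds hf.1 hQ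
  by_cases hsp : W.HasSplitMultiplicativeReductionAtPrime 2
  · have ha₂ : cuspCoeff f 2 = 1 := (hf.cuspCoeff_eq_one_and_sq_of_split hsp).1
    have h2N : 2 ∣ N := hf.dvd_level_of_split hsp
    refine ⟨h2N, not_four_dvd_level_of_split hsp hf, Or.inl ha₂, ?_⟩
    rw [ratPlusSymbol_half_eq_zero_of_cuspCoeff_two_eq_one f hrat hf.1 h2N ha₂, Rat.cast_zero, norm_zero]
    exact zero_le_one
  · obtain ⟨ha₂, h2N⟩ := hf.cuspCoeff_eq_neg_one_and_dvd_of_nonsplit hmult hsp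
    refine ⟨h2N, not_four_dvd_level_of_nonsplit hf hmult hsp, Or.inr ha₂, ?_⟩
    have h2 : ‖(2 : ℚ_[2])‖ = (2 : ℝ)⁻¹ := by
      have h := Padic.norm_p (p := 2)
      simpa using h
    rw [ratPlusSymbol_half_eq_neg_two_mul_of_cuspCoeff_two_eq_neg_one f hrat hf.1 h2N ha₂]
    push_cast
    rw [norm_mul, norm_neg, h2]
    have h0 := norm_ratPlusSymbol_zero_le_two_of_nonsplit hf hmult hsp
    calc (2 : ℝ)⁻¹ * ‖((ratPlusSymbol f 0 : ℚ) : ℚ_[2])‖ ≤ (2 : ℝ)⁻¹ * 2 := by gcongr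
      _ = 1 := by norm_num

/-- **`‖[c/(2ⁿm)]⁺_f‖₂ ≤ 2` at the UNIT classes** (`f` the newform of a curve multiplicative at `2`, `n ≥ 1`, `m` odd and prime
to `N`, `a mod 2ⁿ` and `b mod m` units, `c` the CRT representative of `(a, b)`): `c` is odd and prime to `m`, so the cusp
`c/(2ⁿm)` is `Γ₀(N)`-equivalent to `1/2` (`N = 2M`, `M` odd, `gcd(2ⁿm, M) = 1`: `modularSymbol_div_sub_half_mem_periodLattice`,
Cremona Lemma 2.2.3), `[c/(2ⁿm)]⁺ − [1/2]⁺ ∈ ½ℤ` (`exists_ratPlusSymbol_sub_eq_div_two_of_sub_mem`), and `‖[1/2]⁺‖₂ ≤ 1`.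
[cite: CremonaAlgorithms1997, §2.2 Lemma 2.2.3 and §2.8] [cite: MazurTateTeitelbaum1986Invent, §I.8] -/
theorem norm_ratPlusSymbol_tameFraction_le_two_of_mult_two (hf : IsNewformOf W f)
    (hmult : W.HasMultiplicativeReductionAtPrime 2) (hm2 : m.Coprime 2) (hmN : m.Coprime N) {n : ℕ} (hn : 1 ≤ n)
    {a : ZMod (2 ^ n)} (ha : IsUnit a) {b : ZMod m} (hb : IsUnit b) :
    ‖((ratPlusSymbol f (tameFraction 2 m n a b) : ℚ) : ℚ_[2])‖ ≤ 2 := by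
  haveI : Fact (Nat.Prime 2) := ⟨Nat.prime_two⟩
  haveI : NeZero (2 ^ n) := ⟨pow_ne_zero _ two_ne_zero⟩
  have hQ : coeffField f = ⊥ := hf.coeffField_eq_bot
  have hrat : ∀ r : ℚ, (ratPlusSymbol f r : ℝ) = normalizedPlusSymbol f r := ratCast_ratPlusSymbol_holds hf.1 hQ
  have hreal : ∀ n, (cuspCoeff f n).im = 0 := cuspCoeff_im_eq_zero_of_coeffField_eq_bot hQ
  obtain ⟨h2N, h4N, -, hhalf⟩ := two_dvd_level_and_norm_ratPlusSymbol_half_le_one_of_mult_two hf hmult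
  obtain ⟨M, hM⟩ := h2N
  have hModd : ¬ 2 ∣ M := fun ⟨t, ht⟩ ↦ h4N ⟨t, by rw [hM, ht]; ring⟩
  set c := tameRep 2 m n a b with hc
  -- `c` is odd and prime to `m`
  have hc2 : c.Coprime (2 ^ n) := by
    have h := natCast_tameRep_left (n := n) Nat.prime_two hm2 a b
    rw [← hc] at h
    rw [← h] at ha
    exact (ZMod.isUnit_iff_coprime c (2 ^ n)).mp ha
  have hcm : c.Coprime m := by
    have h := natCast_tameRep_right (n := n) hm2 a b
    rw [← hc] at h
    rw [← h] at hb
    exact (ZMod.isUnit_iff_coprime c m).mp hb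
  have hcden : c.Coprime (2 ^ n * m) := Nat.Coprime.mul_right hc2 hcm
  -- `gcd(2ⁿm, M) = 1`
  have h2M : Nat.Coprime 2 M := (Nat.Prime.coprime_iff_not_dvd Nat.prime_two).mpr hModd
  have hmM : m.Coprime M := Nat.Coprime.coprime_dvd_right ⟨2, by rw [hM]; ring⟩ hmN
  have hdenM : (2 ^ n * m).Coprime M := Nat.Coprime.mul_left (h2M.pow_left n) hmM
  -- the period-lattice membership
  obtain ⟨n', rfl⟩ : ∃ n', n = n' + 1 := ⟨n - 1, by omega⟩
  have hN : (N : ℤ) = 2 * (M : ℤ) := by exact_mod_cast hM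
  have hden : ((2 ^ (n' + 1) * m : ℕ) : ℤ) = 2 * ((2 ^ n' * m : ℕ) : ℤ) := by push_cast; ring
  have hden0 : ((2 ^ (n' + 1) * m : ℕ) : ℤ) ≠ 0 := by
    exact_mod_cast mul_ne_zero (pow_ne_zero _ two_ne_zero) (NeZero.ne m)
  have hac : IsCoprime (c : ℤ) ((2 ^ (n' + 1) * m : ℕ) : ℤ) := Nat.isCoprime_iff_coprime.mpr hcden
  have hcM : IsCoprime ((2 ^ (n' + 1) * m : ℕ) : ℤ) (M : ℤ) := Nat.isCoprime_iff_coprime.mpr hdenM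
  have hmem := modularSymbol_div_sub_half_mem_periodLattice f hN hden hden0 hac hcM
  have hx : ((c : ℤ) : ℚ) / (((2 ^ (n' + 1) * m : ℕ) : ℤ) : ℚ) = tameFraction 2 m (n' + 1) a b := by
    rw [tameFraction, ← hc]
    push_cast
    ring
  rw [hx] at hmem
  obtain ⟨k, hk⟩ := exists_ratPlusSymbol_sub_eq_div_two_of_sub_mem f hrat hreal hmem
  have hk' : ratPlusSymbol f (tameFraction 2 m (n' + 1) a b) = (k : ℚ) / 2 + ratPlusSymbol f (1 / 2) := by
    linear_combination hk
  have h2 : ‖(2 : ℚ_[2])‖ = (2 : ℝ)⁻¹ := by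
    have h := Padic.norm_p (p := 2)
    simpa using h
  have hkn : ‖((k : ℚ_[2])) / 2‖ ≤ 2 := by
    rw [norm_div, h2, div_inv_eq_mul]
    calc ‖(k : ℚ_[2])‖ * 2 ≤ 1 * 2 := by gcongr; exact Padic.norm_int_le_one k
      _ = 2 := one_mul _
  rw [hk']
  push_cast
  refine (Padic.nonarchimedean _ _).trans (max_le hkn (hhalf.trans one_le_two))

/-- **`‖χ(b) · μ¹_{f,a₂,m}((a + 2ⁿℤ₂) × {b})‖₂ ≤ 2` at every UNIT class `a mod 2ⁿ`, `n ≥ 1`** (`f` the newform of a curve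
multiplicative at `2`, `α = a₂ = ±1`, `m` odd prime to `N`, any `ℚ₂`-valued `χ`): for `b` a unit by
`norm_ratPlusSymbol_tameFraction_le_two_of_mult_two` (`‖α⁻ⁿ‖ = 1`, `‖χ(b)‖ ≤ 1`), and `χ(b) = 0` off the units.
[cite: MazurTateTeitelbaum1986Invent, §I.10 (10.1) (pp. 12–13)] -/
theorem norm_mul_msdMeasureTameMult_two_le_two (hf : IsNewformOf W f)
    (hmult : W.HasMultiplicativeReductionAtPrime 2) (hm2 : m.Coprime 2) (hmN : m.Coprime N)
    {α : ℚ_[2]} (hαu : ‖α‖ = 1) (χ : DirichletCharacter ℚ_[2] m) {n : ℕ} (hn : 1 ≤ n)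
    {a : ZMod (2 ^ n)} (ha : IsUnit a) (b : ZMod m) :
    ‖χ b * msdMeasureTameMult f m α n a b‖ ≤ 2 := by
  by_cases hb : IsUnit b
  · obtain ⟨u, rfl⟩ := hb
    have hχ : ‖χ (u : ZMod m)‖ ≤ 1 := by
      have hfin : IsOfFinOrder (χ.toUnitHom u) := MonoidHom.isOfFinOrder _ (isOfFinOrder_of_finite u)
      obtain ⟨k, hk, hpow⟩ := hfin.exists_pow_eq_one
      have hval : (χ (u : ZMod m)) ^ k = 1 := by
        have := congr_arg (fun x : ℚ_[2]ˣ ↦ (x : ℚ_[2])) hpow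
        simpa [MulChar.coe_toUnitHom] using this
      have hnk : ‖χ (u : ZMod m)‖ ^ k = 1 := by rw [← norm_pow, hval, norm_one]
      exact (pow_eq_one_iff_of_nonneg (norm_nonneg _) hk.ne').mp hnk |>.le
    have hαi : ‖α⁻¹‖ = 1 := by rw [norm_inv, hαu, inv_one]
    rw [norm_mul, msdMeasureTameMult, norm_mul, norm_pow, hαi, one_pow, one_mul]
    calc ‖χ (u : ZMod m)‖ * ‖((ratPlusSymbol f (tameFraction 2 m n a u) : ℚ) : ℚ_[2])‖ ≤ 1 * 2 :=
        mul_le_mul hχ (norm_ratPlusSymbol_tameFraction_le_two_of_mult_two hf hmult hm2 hmN hn ha u.isUnit)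
          (norm_nonneg _) zero_le_one
      _ = 2 := one_mul _
  · rw [χ.map_nonunit hb, zero_mul, norm_zero]
    exact zero_le_two

/-- **Each doubled Riemann sum has norm `≤ 1`**: for `χ` even, `‖padicLRiemannSumTameMult f m α χ k n‖₂ ≤ 1` (`2 ×` a sum of
terms of norm `≤ 2` at the unit classes `5ˢ mod 2ⁿ⁺²`; binomials are integers; ultrametric).
[cite: MazurTateTeitelbaum1986Invent, §I.12–I.13 (pp. 17–19)] -/
theorem norm_padicLRiemannSumTameMult_two_le_one (hf : IsNewformOf W f)
    (hmult : W.HasMultiplicativeReductionAtPrime 2) (hm2 : m.Coprime 2) (hmN : m.Coprime N)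
    {α : ℚ_[2]} (hαu : ‖α‖ = 1) (χ : DirichletCharacter ℚ_[2] m) (hχ : χ.Even) (k n : ℕ) :
    ‖padicLRiemannSumTameMult f m α χ k n‖ ≤ 1 := by
  haveI : Fact (Nat.Prime 2) := ⟨Nat.prime_two⟩
  have h2 : ‖(2 : ℚ_[2])‖ = (2 : ℝ)⁻¹ := by
    have h := Padic.norm_p (p := 2)
    simpa using h
  rw [padicLRiemannSumTameMult_two_of_even f hm2 α χ hχ, norm_mul, h2]
  have hS : ‖∑ s : ZMod (2 ^ n), ∑ b : ZMod m,
      χ b * msdMeasureTameMult f m α (n + 2) ((cyclotomicGenerator 2 : ZMod (2 ^ (n + 2))) ^ s.val) b *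
        (s.val.choose k : ℚ_[2])‖ ≤ 2 := by
    refine IsUltrametricDist.norm_sum_le_of_forall_le_of_nonneg zero_le_two fun s _ ↦ ?_
    refine IsUltrametricDist.norm_sum_le_of_forall_le_of_nonneg zero_le_two fun b _ ↦ ?_
    have hc : ‖((s.val.choose k : ℕ) : ℚ_[2])‖ ≤ 1 := by
      have h := Padic.norm_int_le_one (p := 2) ((s.val.choose k : ℕ) : ℤ)
      rwa [Int.cast_natCast] at h
    have hu : IsUnit ((cyclotomicGenerator 2 : ZMod (2 ^ (n + 2))) ^ s.val) :=
      (isUnit_cyclotomicGenerator_cast (p := 2) (n + 2)).pow _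
    rw [norm_mul]
    calc _ ≤ 2 * 1 := mul_le_mul (norm_mul_msdMeasureTameMult_two_le_two hf hmult hm2 hmN hαu χ (by omega) hu b) hc
          (norm_nonneg _) zero_le_two
      _ = 2 := mul_one _
  calc (2 : ℝ)⁻¹ * _ ≤ (2 : ℝ)⁻¹ * 2 := by gcongr
    _ = 1 := by norm_num

/-- **Termwise congruence with the doubling** (Matsuno 2000, proof of Lemma 3.2, at `p = 2`, one-term measure): for `χ`, `χ'`
EVEN with `‖χ(b) − χ'(b)‖ ≤ ‖2‖` on units and `χ(b) = χ'(b) = 0` off units (e.g. `χ' = 𝟙_m`, `χ` quadratic), the Riemann sums of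
`L₂(f,α,χ)` and `L₂(f,α,χ')` differ by at most `‖2‖ · ‖2‖ · 2 = ‖2‖`. [cite: Matsuno2000, Lemma 3.2 (p. 87), proof] -/
theorem norm_padicLRiemannSumTameMult_sub_two_le (hf : IsNewformOf W f)
    (hmult : W.HasMultiplicativeReductionAtPrime 2) (hm2 : m.Coprime 2) (hmN : m.Coprime N)
    {α : ℚ_[2]} (hαu : ‖α‖ = 1) (χ χ' : DirichletCharacter ℚ_[2] m) (hχ : χ.Even) (hχ' : χ'.Even)
    (hχχ' : ∀ b : ZMod m, ‖χ b - χ' b‖ ≤ ‖(2 : ℚ_[2])‖) (k n : ℕ) :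
    ‖padicLRiemannSumTameMult f m α χ k n - padicLRiemannSumTameMult f m α χ' k n‖ ≤ ‖(2 : ℚ_[2])‖ := by
  haveI : Fact (Nat.Prime 2) := ⟨Nat.prime_two⟩
  have h2 : ‖(2 : ℚ_[2])‖ = (2 : ℝ)⁻¹ := by
    have h := Padic.norm_p (p := 2)
    simpa using h
  rw [padicLRiemannSumTameMult_two_of_even f hm2 α χ hχ, padicLRiemannSumTameMult_two_of_even f hm2 α χ' hχ', ← mul_sub,
    norm_mul, ← Finset.sum_sub_distrib]
  have hS : ‖∑ s : ZMod (2 ^ n), (∑ b : ZMod m,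
      χ b * msdMeasureTameMult f m α (n + 2) ((cyclotomicGenerator 2 : ZMod (2 ^ (n + 2))) ^ s.val) b *
        (s.val.choose k : ℚ_[2]) -
      ∑ b : ZMod m,
      χ' b * msdMeasureTameMult f m α (n + 2) ((cyclotomicGenerator 2 : ZMod (2 ^ (n + 2))) ^ s.val) b *
        (s.val.choose k : ℚ_[2]))‖ ≤ 1 := by
    refine IsUltrametricDist.norm_sum_le_of_forall_le_of_nonneg zero_le_one fun s _ ↦ ?_
    rw [← Finset.sum_sub_distrib]
    refine IsUltrametricDist.norm_sum_le_of_forall_le_of_nonneg zero_le_one fun b _ ↦ ?_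
    have hc : ‖((s.val.choose k : ℕ) : ℚ_[2])‖ ≤ 1 := by
      have h := Padic.norm_int_le_one (p := 2) ((s.val.choose k : ℕ) : ℤ)
      rwa [Int.cast_natCast] at h
    have hu : IsUnit ((cyclotomicGenerator 2 : ZMod (2 ^ (n + 2))) ^ s.val) :=
      (isUnit_cyclotomicGenerator_cast (p := 2) (n + 2)).pow _
    rw [← sub_mul, ← sub_mul, norm_mul, norm_mul]
    by_cases hb : IsUnit b
    · have hμ : ‖msdMeasureTameMult f m α (n + 2) ((cyclotomicGenerator 2 : ZMod (2 ^ (n + 2))) ^ s.val) b‖ ≤ 2 := by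
        have hαi : ‖α⁻¹‖ = 1 := by rw [norm_inv, hαu, inv_one]
        rw [msdMeasureTameMult, norm_mul, norm_pow, hαi, one_pow, one_mul]
        exact norm_ratPlusSymbol_tameFraction_le_two_of_mult_two hf hmult hm2 hmN (by omega) hu hb
      calc ‖χ b - χ' b‖ * ‖msdMeasureTameMult f m α (n + 2) _ b‖ * ‖((s.val.choose k : ℕ) : ℚ_[2])‖
          ≤ ‖(2 : ℚ_[2])‖ * 2 * 1 :=
            mul_le_mul (mul_le_mul (hχχ' b) hμ (norm_nonneg _) (norm_nonneg _)) hc (norm_nonneg _) (by positivity)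
        _ = 1 := by rw [h2]; norm_num
    · rw [χ.map_nonunit hb, χ'.map_nonunit hb, sub_self, norm_zero, zero_mul, zero_mul]
      exact zero_le_one
  calc ‖(2 : ℚ_[2])‖ * _ ≤ ‖(2 : ℚ_[2])‖ * 1 := by gcongr
    _ = ‖(2 : ℚ_[2])‖ := mul_one _

end Symbols

/-! ### §3. Integrality of `L₂(f, a₂, χ, T)` and Lemma 3.2 at `p = 2` -/

section Integrality

variable {N : ℕ} [NeZero N] {f : CuspForm (Gamma0 N) 2} {m : ℕ} [NeZero m]
  {W : WeierstrassCurve ℚ}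

omit [NeZero m] in
/-- The trivial character mod `m` is even; private helper. [folklore] -/
private theorem even_one_dirichletCharacter' {R : Type*} [CommRing R] : (1 : DirichletCharacter R m).Even := by
  show (1 : DirichletCharacter R m) (-1) = 1
  rw [show (-1 : ZMod m) = (((-1 : (ZMod m)ˣ) : (ZMod m)ˣ) : ZMod m) by simp, MulChar.one_apply_coe]

/-- Convergence of the one-term tame Riemann sums for the newform of a curve multiplicative at `2` at `α = a₂(f)`
(`tendsto_padicLRiemannSumTameMult` with `2 ∣ N`, `a₂ = ±1`, `‖a₂‖₂ = 1`). [cite: MazurTateTeitelbaum1986Invent, §I.11–I.13 (pp. 13–19)] -/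
theorem tendsto_padicLRiemannSumTameMult_two_of_mult (hf : IsNewformOf W f)
    (hmult : W.HasMultiplicativeReductionAtPrime 2) (hm2 : m.Coprime 2) {ap : ℤ} (hap : cuspCoeff f 2 = ap)
    (χ : DirichletCharacter ℚ_[2] m) (k : ℕ) :
    Tendsto (padicLRiemannSumTameMult f m (ap : ℚ_[2]) χ k) atTop (𝓝 (padicLCoeffTameMult f m (ap : ℚ_[2]) χ k)) := by
  haveI : Fact (Nat.Prime 2) := ⟨Nat.prime_two⟩
  obtain ⟨h2N, -, ha₂, -⟩ := two_dvd_level_and_norm_ratPlusSymbol_half_le_one_of_mult_two hf hmult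
  have hap1 : ap = 1 ∨ ap = -1 := by
    rcases ha₂ with h | h
    · left; exact_mod_cast (hap.symm.trans h)
    · right; exact_mod_cast (hap.symm.trans h)
  have hαu : ‖((ap : ℤ) : ℚ_[2])‖ = 1 := by
    rcases hap1 with rfl | rfl <;> simp
  exact tendsto_padicLRiemannSumTameMult hf.1 hf.coeffField_eq_bot h2N hm2 hap rfl hαu χ k

/-- **INT2-AUTO at tame level, multiplicative `2`: `‖[Tᵏ] L₂(f, a₂, χ, T)‖₂ ≤ 1`** for `E = W/ℚ` multiplicative at `2`, `f` its
newform, `m` odd prime to `N`, `χ` an EVEN `ℚ₂`-valued character mod `m` — each Riemann sum has norm `≤ 1`, they converge, the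
unit ball is closed. No hypothesis on `E[2]`, the `2`-adic image or the Manin constant.
[cite: MazurTateTeitelbaum1986Invent, §I.10 and §I.12–I.13 (p = 2)] [cite: CremonaAlgorithms1997, §2.2 Lemma 2.2.3] -/
theorem norm_padicLCoeffTameMult_two_le_one (hf : IsNewformOf W f)
    (hmult : W.HasMultiplicativeReductionAtPrime 2) (hm2 : m.Coprime 2) (hmN : m.Coprime N) {ap : ℤ}
    (hap : cuspCoeff f 2 = ap) (χ : DirichletCharacter ℚ_[2] m) (hχ : χ.Even) (k : ℕ) :
    ‖padicLCoeffTameMult f m (ap : ℚ_[2]) χ k‖ ≤ 1 := by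
  obtain ⟨-, -, ha₂, -⟩ := two_dvd_level_and_norm_ratPlusSymbol_half_le_one_of_mult_two hf hmult
  have hαu : ‖((ap : ℤ) : ℚ_[2])‖ = 1 := by
    rcases ha₂ with h | h
    · have : ap = 1 := by exact_mod_cast (hap.symm.trans h)
      subst this; simp
    · have : ap = -1 := by exact_mod_cast (hap.symm.trans h)
      subst this; simp
  exact le_of_tendsto (tendsto_padicLRiemannSumTameMult_two_of_mult hf hmult hm2 hap χ k).norm
    (Eventually.of_forall fun n ↦ norm_padicLRiemannSumTameMult_two_le_one hf hmult hm2 hmN hαu χ hχ k n)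

/-- **`L₂(f, a₂, χ, T) ∈ Λ = ℤ₂⟦T⟧`** under the hypotheses of `norm_padicLCoeffTameMult_two_le_one` (coefficientwise criterion
`exists_iwasawaToPowerSeries_eq_iff_norm_coeff_le_one`). [cite: MazurTateTeitelbaum1986Invent, §I.12 (p. 17)] -/
theorem exists_iwasawaToPowerSeries_eq_padicLFunctionTameMult_two (hf : IsNewformOf W f)
    (hmult : W.HasMultiplicativeReductionAtPrime 2) (hm2 : m.Coprime 2) (hmN : m.Coprime N) {ap : ℤ}
    (hap : cuspCoeff f 2 = ap) (χ : DirichletCharacter ℚ_[2] m) (hχ : χ.Even) :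
    ∃ G : IwasawaAlgebra 2, iwasawaToPowerSeries 2 G = padicLFunctionTameMult f m (ap : ℚ_[2]) χ :=
  (exists_iwasawaToPowerSeries_eq_iff_norm_coeff_le_one _).mpr fun k ↦ by
    rw [coeff_padicLFunctionTameMult]
    exact norm_padicLCoeffTameMult_two_le_one hf hmult hm2 hmN hap χ hχ k

/-- **Matsuno 2000, Lemma 3.2 at a multiplicative `2` (one-term transform, tree normalisation).** For `E = W/ℚ` multiplicative at
`2`, `f` its newform, `m` odd prime to `N`, and `χ` an even QUADRATIC `ℚ₂`-valued character mod `m` (e.g. `χ_d`, `d > 0`): for every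
`k`, `‖[T^k] L₂(f,a₂,χ) − [T^k] L₂(f,a₂,𝟙_m)‖₂ ≤ ‖2‖₂` — "`G_{p,m}(E, φψ, T) ≡ G_{p,m}(E, φ, T) (mod π)`" with `φ = 1`, `ψ = χ`,
`π = 2`. [cite: Matsuno2000, Lemma 3.2 (p. 87)] -/
theorem norm_padicLCoeffTameMult_sub_one_two_le (hf : IsNewformOf W f)
    (hmult : W.HasMultiplicativeReductionAtPrime 2) (hm2 : m.Coprime 2) (hmN : m.Coprime N) {ap : ℤ}
    (hap : cuspCoeff f 2 = ap) (χ : DirichletCharacter ℚ_[2] m) (hχ : χ.Even) (hsq : χ ^ 2 = 1) (k : ℕ) :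
    ‖padicLCoeffTameMult f m (ap : ℚ_[2]) χ k -
        padicLCoeffTameMult f m (ap : ℚ_[2]) (1 : DirichletCharacter ℚ_[2] m) k‖ ≤ ‖(2 : ℚ_[2])‖ := by
  obtain ⟨-, -, ha₂, -⟩ := two_dvd_level_and_norm_ratPlusSymbol_half_le_one_of_mult_two hf hmult
  have hαu : ‖((ap : ℤ) : ℚ_[2])‖ = 1 := by
    rcases ha₂ with h | h
    · have : ap = 1 := by exact_mod_cast (hap.symm.trans h)
      subst this; simp
    · have : ap = -1 := by exact_mod_cast (hap.symm.trans h)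
      subst this; simp
  exact le_of_tendsto ((tendsto_padicLRiemannSumTameMult_two_of_mult hf hmult hm2 hap χ k).sub
    (tendsto_padicLRiemannSumTameMult_two_of_mult hf hmult hm2 hap 1 k)).norm (Eventually.of_forall fun n ↦
      norm_padicLRiemannSumTameMult_sub_two_le hf hmult hm2 hmN hαu χ 1 hχ even_one_dirichletCharacter'
        (norm_sub_one_apply_le_of_sq_eq_one χ hsq) k n)

/-- **`L₂(f,a₂,χ) ≡ L₂(f,a₂,𝟙_m) (mod 2Λ)` as reductions of integral lifts, multiplicative `2`** (Matsuno 2000, Lemma 3.2 at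
`p = 2` in the currency of the cell's congruence `hcong`): under the hypotheses of `norm_padicLCoeffTameMult_sub_one_two_le` there
are `G, G₁ ∈ ℤ₂⟦T⟧` with `ι G = L₂(f,a₂,χ,T)`, `ι G₁ = L₂(f,a₂,𝟙_m,T)` and `G mod 2 = G₁ mod 2` in `𝔽₂⟦T⟧`.
[cite: Matsuno2000, Lemma 3.2 (p. 87)] [cite: MazurTateTeitelbaum1986Invent, §I.12 (p. 17)] -/
theorem exists_iwasawa_pair_map_toZMod_eq_two_mult (hf : IsNewformOf W f)
    (hmult : W.HasMultiplicativeReductionAtPrime 2) (hm2 : m.Coprime 2) (hmN : m.Coprime N) {ap : ℤ}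
    (hap : cuspCoeff f 2 = ap) (χ : DirichletCharacter ℚ_[2] m) (hχ : χ.Even) (hsq : χ ^ 2 = 1) :
    ∃ G G₁ : IwasawaAlgebra 2,
      iwasawaToPowerSeries 2 G = padicLFunctionTameMult f m (ap : ℚ_[2]) χ ∧
      iwasawaToPowerSeries 2 G₁ = padicLFunctionTameMult f m (ap : ℚ_[2]) (1 : DirichletCharacter ℚ_[2] m) ∧
      PowerSeries.map (PadicInt.toZMod (p := 2)) G = PowerSeries.map (PadicInt.toZMod (p := 2)) G₁ := by
  refine exists_iwasawa_pair_map_toZMod_eq _ _ (fun k ↦ ?_) (fun k ↦ ?_) (fun k ↦ ?_)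
  · rw [coeff_padicLFunctionTameMult]
    exact norm_padicLCoeffTameMult_two_le_one hf hmult hm2 hmN hap χ hχ k
  · rw [coeff_padicLFunctionTameMult]
    exact norm_padicLCoeffTameMult_two_le_one hf hmult hm2 hmN hap 1 even_one_dirichletCharacter' k
  · rw [coeff_padicLFunctionTameMult, coeff_padicLFunctionTameMult]
    have h2 : ‖(2 : ℚ_[2])‖ = (2 : ℝ)⁻¹ := by
      have h := Padic.norm_p (p := 2)
      simpa using h
    have h := norm_padicLCoeffTameMult_sub_one_two_le hf hmult hm2 hmN hap χ hχ hsq k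
    rw [h2] at h
    linarith

end Integrality

end Literature.NumberTheory.EllipticCurves

end
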